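import Summits.KontsevichZagierPeriods.KontsevichZagierPeriods.Theorems.MultiplicationThree.Negative.Additivity

/-!
# `MultiplicationThree` (stmt-KontsevichZagierPeriods-3598) — negative knowledge, part 4: load-bearing hypotheses

* §3a each of the four pinning clauses `hr`, `hri`, `hr'`, `hri'` is load-bearing: the variant with
  it dropped is refuted by evaluation (`multiplicationThree_false_without_hr / _hri / _hr' / _hri'`;
  witnesses: empty-domain / zero-integrand representations against the positive value of the other
  side at `s = 1`); value positivity `boxRep_value_pos`, `simplexRep_value_pos`.
* §3b the guard `0 < s` is NOT load-bearing: `multiplicationThreeWithout_pos_iff` — dropping it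
  gives an equivalent statement, since for `s ≤ 0` no representation satisfies the box pinning
  (`no_boxRep_of_nonpos`: `t^{-1/3}(1-t)^{s-1}` is not integrable at `t = 1⁻`).
(cdisprove gen 1.)
-/

noncomputable section

open MeasureTheory Set Real
open scoped BigOperators

namespace Summit.KontsevichZagierPeriods.TerasomaMultiplication.MultiplicationThreeNegative

open Literature.NumberTheory.Transcendental
open Literature.NumberTheory.Transcendental.KZ
open Literature.ModelTheory.ExponentialFields (IsSemialgebraic)
open MvPolynomial (aeval X C)
open Summit.KontsevichZagierPeriods.KontsevichZagierPeriods.Theses.TerasomaMultiplication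
  (MultiplicationThree)

/-! ## §3 Load-bearing analysis of the hypotheses

The crux has five hypotheses: `hs : 0 < s` and the four pinning clauses `hr`, `hri`, `hr'`, `hri'`.
The four pinning clauses are each load-bearing (dropping any one is refuted by EVALUATION, below);
`hs` is NOT load-bearing: for `s ≤ 0` no absolutely convergent representation satisfies `hr ∧ hri`
(§3b), so the guard only discards vacuous instances. -/

/-- A representation with empty domain (value `0`), integrand arbitrary. [folklore] -/
def emptyRep (f : (Fin 2 → ℝ) → ℝ) : IntegralRep 2 where
  domain := ∅
  integrand := f
  isSemialgebraic_domain := Literature.ModelTheory.ExponentialFields.isSemialgebraic_empty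
  isSemialgebraicFunOn_integrand :=
    (isSemialgebraicFunOn_aeval Literature.ModelTheory.ExponentialFields.isSemialgebraic_empty
      (0 : MvPolynomial (Fin 2) ℚ)).congr fun _ hx => hx.elim
  integrableOn := integrableOn_empty

/-- The empty representation has value `0`. [folklore] -/
theorem emptyRep_value (f : (Fin 2 → ℝ) → ℝ) : (emptyRep f).value = 0 := by
  simp [IntegralRep.value, emptyRep]

/-- The zero representation on a `ℚ`-semialgebraic set (value `0`). [folklore] -/
def zeroRep (σ : Set (Fin 2 → ℝ)) (hσ : IsSemialgebraic ℚ σ) : IntegralRep 2 where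
  domain := σ
  integrand := 0
  isSemialgebraic_domain := hσ
  isSemialgebraicFunOn_integrand := (isSemialgebraicFunOn_aeval hσ 0).congr fun x _ => by simp
  integrableOn := integrableOn_zero

/-- The zero representation has value `0`. [folklore] -/
theorem zeroRep_value (σ : Set (Fin 2 → ℝ)) (hσ : IsSemialgebraic ℚ σ) : (zeroRep σ hσ).value = 0 := by
  simp [IntegralRep.value, zeroRep]

/-- The unit box has volume `1`. [folklore] -/
theorem volume_box : volume box = 1 := by
  rw [box_eq_pi, Real.volume_pi_Ioo]
  simp

/-- The box integrand is positive on the box. [folklore] -/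
theorem boxFun_pos (s : ℚ) {x : Fin 2 → ℝ} (hx : x ∈ box) : 0 < boxFun s x := by
  have h0 := hx 0
  have h1 := hx 1
  unfold boxFun
  exact mul_pos (mul_pos (mul_pos (Real.rpow_pos_of_pos h0.1 _)
    (Real.rpow_pos_of_pos (sub_pos.2 h0.2) _)) (Real.rpow_pos_of_pos h1.1 _))
    (Real.rpow_pos_of_pos (sub_pos.2 h1.2) _)

/-- **The box side has positive value.** [folklore] -/
theorem boxRep_value_pos {s : ℚ} (hs : 0 < s) : 0 < (boxRep s hs).value := by
  show 0 < ∫ x in box, boxFun s x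
  rw [setIntegral_pos_iff_support_of_nonneg_ae ?_ (integrableOn_boxFun hs)]
  · have : box ⊆ Function.support (boxFun s) ∩ box := fun x hx => ⟨(boxFun_pos s hx).ne', hx⟩
    refine lt_of_lt_of_le ?_ (measure_mono this)
    rw [volume_box]; exact one_pos
  · exact ae_restrict_of_forall_mem measurableSet_box fun x hx => (boxFun_pos s hx).le

/-- The simplex integrand is positive on the triangle. [folklore] -/
theorem simplexFun_pos (s : ℚ) {x : Fin 2 → ℝ} (hx : x ∈ triangle) : 0 < simplexFun s x := by
  obtain ⟨h0, h1, h2⟩ := hx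
  exact Real.rpow_pos_of_pos (mul_pos (mul_pos h0 h1) (by linarith)) _

/-- **The simplex side has positive value.** [folklore] -/
theorem simplexRep_value_pos {s : ℚ} (hs : 0 < s) : 0 < (simplexRep s hs).value := by
  show 0 < ∫ x in triangle, simplexFun s x
  rw [setIntegral_pos_iff_support_of_nonneg_ae ?_ (integrableOn_simplexFun hs)]
  · have : window 2 ⊆ Function.support (simplexFun s) ∩ triangle := fun x hx =>
      ⟨(simplexFun_pos s (window_subset_triangle hx)).ne', window_subset_triangle hx⟩
    exact volume_window_pos.trans_le (measure_mono this)
  · exact ae_restrict_of_forall_mem measurableSet_triangle fun x hx => (simplexFun_pos s hx).le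

/-! ### §3a The four pinning hypotheses are load-bearing -/

/-- The crux with `hr : r.domain = box` dropped. -/
def MultiplicationThreeWithout_hr : Prop :=
  ∀ s : ℚ, 0 < s → ∀ (r r' : IntegralRep 2),
    EqOn r.integrand (boxFun s) r.domain → r'.domain = triangle →
    EqOn r'.integrand (simplexFun s) r'.domain → Equivalent r r'

/-- The crux with `hri : EqOn r.integrand (boxFun s) r.domain` dropped. -/
def MultiplicationThreeWithout_hri : Prop :=
  ∀ s : ℚ, 0 < s → ∀ (r r' : IntegralRep 2), r.domain = box → r'.domain = triangle →
    EqOn r'.integrand (simplexFun s) r'.domain → Equivalent r r'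

/-- The crux with `hr' : r'.domain = triangle` dropped. -/
def MultiplicationThreeWithout_hr' : Prop :=
  ∀ s : ℚ, 0 < s → ∀ (r r' : IntegralRep 2), r.domain = box →
    EqOn r.integrand (boxFun s) r.domain →
    EqOn r'.integrand (simplexFun s) r'.domain → Equivalent r r'

/-- The crux with `hri' : EqOn r'.integrand (simplexFun s) r'.domain` dropped. -/
def MultiplicationThreeWithout_hri' : Prop :=
  ∀ s : ℚ, 0 < s → ∀ (r r' : IntegralRep 2), r.domain = box →
    EqOn r.integrand (boxFun s) r.domain → r'.domain = triangle → Equivalent r r'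

/-- Dropping `hr` is refuted by evaluation: `r = [∅, boxFun 1]` (value 0) against the simplex side
(value `> 0`). [folklore] -/
theorem multiplicationThree_false_without_hr : ¬ MultiplicationThreeWithout_hr := by
  intro h
  have he := h 1 one_pos (emptyRep (boxFun 1)) (simplexRep 1 one_pos) (fun _ _ => rfl) rfl
    (fun _ _ => rfl)
  have hv := Equivalent.value_eq_holds he
  rw [emptyRep_value] at hv
  linarith [simplexRep_value_pos (s := 1) one_pos]

/-- Dropping `hri` is refuted by evaluation: `r = [box, 0]` against the simplex side. [folklore] -/
theorem multiplicationThree_false_without_hri : ¬ MultiplicationThreeWithout_hri := by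
  intro h
  have he := h 1 one_pos (zeroRep box isSemialgebraic_box) (simplexRep 1 one_pos) rfl rfl
    (fun _ _ => rfl)
  have hv := Equivalent.value_eq_holds he
  rw [zeroRep_value] at hv
  linarith [simplexRep_value_pos (s := 1) one_pos]

/-- Dropping `hr'` is refuted by evaluation: the box side against `r' = [∅, simplexFun 1]`. [folklore] -/
theorem multiplicationThree_false_without_hr' : ¬ MultiplicationThreeWithout_hr' := by
  intro h
  have he := h 1 one_pos (boxRep 1 one_pos) (emptyRep (simplexFun 1)) rfl (fun _ _ => rfl)
    (fun _ _ => rfl)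
  have hv := Equivalent.value_eq_holds he
  rw [emptyRep_value] at hv
  linarith [boxRep_value_pos (s := 1) one_pos]

/-- Dropping `hri'` is refuted by evaluation: the box side against `r' = [triangle, 0]`. [folklore] -/
theorem multiplicationThree_false_without_hri' : ¬ MultiplicationThreeWithout_hri' := by
  intro h
  have he := h 1 one_pos (boxRep 1 one_pos) (zeroRep triangle isSemialgebraic_triangle) rfl
    (fun _ _ => rfl) rfl
  have hv := Equivalent.value_eq_holds he
  rw [zeroRep_value] at hv
  linarith [boxRep_value_pos (s := 1) one_pos]


/-! ### §3b The guard `0 < s` is not load-bearing: for `s ≤ 0` the box side does not exist -/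

/-- For `s ≤ 0` the Beta factor `t^{-1/3}(1-t)^{s-1}` is NOT integrable on `(0,1)`: on `(1/2,1)`
it dominates `(1-t)^{s-1}`, whose reflection `u^{s-1}` is integrable at `0⁺` iff `s > 0`
(`intervalIntegral.integrableOn_Ioo_rpow_iff`). [folklore] -/
theorem not_integrableOn_boxFactor_one {s : ℚ} (hs : s ≤ 0) :
    ¬ IntegrableOn (boxFactor s 1) (Ioo (0:ℝ) 1) := by
  intro h
  have hsR : (s:ℝ) ≤ 0 := by exact_mod_cast hs
  -- Step 1: `(1-t)^(s-1)` is integrable on `(1/2, 1)`.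
  have h1 : IntegrableOn (fun t : ℝ => (1 - t) ^ ((s:ℝ) - 1)) (Ioo (1/2 : ℝ) 1) := by
    have hm : AEStronglyMeasurable (fun t : ℝ => (1 - t) ^ ((s:ℝ) - 1))
        (volume.restrict (Ioo (1/2 : ℝ) 1)) :=
      (ContinuousOn.rpow_const (by fun_prop) (fun t ht => Or.inl (by
        have : t < 1 := ht.2; exact (sub_pos.2 this).ne'))).aestronglyMeasurable measurableSet_Ioo
    refine (h.mono_set (Ioo_subset_Ioo (by norm_num) le_rfl)).mono' hm ?_
    filter_upwards [ae_restrict_mem measurableSet_Ioo] with t ht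
    have ht0 : 0 < t := by linarith [ht.1]
    have ht1 : 0 < 1 - t := sub_pos.2 ht.2
    have hk : 0 ≤ (1 - t) ^ ((s:ℝ) - 1) := (Real.rpow_pos_of_pos ht1 _).le
    rw [Real.norm_eq_abs, abs_of_nonneg hk]
    have hge : 1 ≤ t ^ (-(1:ℝ)/3) :=
      Real.one_le_rpow_of_pos_of_le_one_of_nonpos ht0 ht.2.le (by norm_num)
    simp only [boxFactor, Matrix.cons_val_one, Matrix.cons_val_zero]
    nlinarith
  -- Step 2: reflect `t ↦ 1 - t`: `u^(s-1)` is integrable on `(0, 1/2)`.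
  have h2 : IntegrableOn (fun u : ℝ => u ^ ((s:ℝ) - 1)) (Ioo (0:ℝ) (1/2)) := by
    have hI : IntervalIntegrable (fun t : ℝ => (1 - t) ^ ((s:ℝ) - 1)) volume (1/2) 1 :=
      (intervalIntegrable_iff_integrableOn_Ioo_of_le (by norm_num)).2 h1
    have hI' := hI.comp_sub_left 1
    have e : (fun x : ℝ => (1 - (1 - x)) ^ ((s:ℝ) - 1)) = fun u => u ^ ((s:ℝ) - 1) := by
      funext x; ring_nf
    rw [e, show (1:ℝ) - 1/2 = 1/2 by norm_num, sub_self] at hI'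
    exact (intervalIntegrable_iff_integrableOn_Ioo_of_le (by norm_num)).1 hI'.symm
  -- Step 3: contradiction with the integrability criterion at `0⁺`.
  have := (intervalIntegral.integrableOn_Ioo_rpow_iff (by norm_num : (0:ℝ) < 1/2)).1 h2
  linarith

/-- If the box integrand is integrable on the box then its second factor is integrable on `(0,1)`
(Tonelli through `Fin 2 → ℝ ≃ ℝ × ℝ`; the first factor is positive). [folklore] -/
theorem integrableOn_boxFactor_one_of_boxFun {s : ℚ} (h : IntegrableOn (boxFun s) box) :
    IntegrableOn (boxFactor s 1) (Ioo (0:ℝ) 1) := by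
  rw [IntegrableOn, volume_restrict_box] at h
  set ρ : Measure ℝ := (volume : Measure ℝ).restrict (Ioo (0:ℝ) 1) with hρ
  have hmp : MeasurePreserving (MeasurableEquiv.finTwoArrow (α := ℝ)).symm (ρ.prod ρ)
      (Measure.pi fun _ : Fin 2 => ρ) := (measurePreserving_finTwoArrow ρ).symm _
  have h' : Integrable (fun p : ℝ × ℝ => boxFactor s 0 p.1 * boxFactor s 1 p.2) (ρ.prod ρ) := by
    have := (hmp.integrable_comp_emb (MeasurableEquiv.measurableEmbedding _)).2 h
    refine this.congr (ae_of_all _ fun p => ?_)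
    simp [boxFun_eq_prod, Fin.prod_univ_two]
  have hae := h'.prod_right_ae
  have hρ0 : ρ ≠ 0 := by
    intro h0
    have : ρ univ = 0 := by rw [h0]; rfl
    rw [hρ, Measure.restrict_apply MeasurableSet.univ, univ_inter, Real.volume_Ioo] at this
    norm_num at this
  haveI : (ae ρ).NeBot := ae_neBot.2 hρ0
  obtain ⟨a, ha, hamem⟩ := (hae.and (ae_restrict_mem measurableSet_Ioo)).exists
  have hbox : (![a, a] : Fin 2 → ℝ) ∈ box := Fin.forall_fin_two.mpr ⟨hamem, hamem⟩
  have hpos : 0 < boxFactor s 0 a := by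
    simp only [boxFactor, Matrix.cons_val_zero]
    exact mul_pos (Real.rpow_pos_of_pos hamem.1 _) (Real.rpow_pos_of_pos (sub_pos.2 hamem.2) _)
  have := ha.const_mul (boxFactor s 0 a)⁻¹
  refine this.congr (ae_of_all _ fun t => ?_)
  simp only
  rw [← mul_assoc, inv_mul_cancel₀ hpos.ne', one_mul]

/-- **For `s ≤ 0` no representation satisfies the box pinning** `hr ∧ hri`: the integrand is not
absolutely integrable, but `integrableOn` is a field of `KZ.IntegralRep`. [folklore] -/
theorem no_boxRep_of_nonpos {s : ℚ} (hs : s ≤ 0) (r : IntegralRep 2) (hr : r.domain = box)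
    (hri : EqOn r.integrand (boxFun s) r.domain) : False := by
  have h : IntegrableOn (boxFun s) box := by
    have := r.integrableOn
    rw [hr] at this hri
    exact this.congr_fun hri measurableSet_box
  exact not_integrableOn_boxFactor_one hs (integrableOn_boxFactor_one_of_boxFun h)

/-- The crux with the guard `0 < s` dropped. -/
def MultiplicationThreeWithout_pos : Prop :=
  ∀ s : ℚ, ∀ (r r' : IntegralRep 2), r.domain = box →
    EqOn r.integrand (boxFun s) r.domain → r'.domain = triangle →
    EqOn r'.integrand (simplexFun s) r'.domain → Equivalent r r'

/-- **`0 < s` is not load-bearing**: the guard-free statement is EQUIVALENT to the crux, because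
its extra instances (`s ≤ 0`) are vacuous (`no_boxRep_of_nonpos`). A proof of the crux may use
`0 < s` only to know that the data exist. [folklore] -/
theorem multiplicationThreeWithout_pos_iff : MultiplicationThreeWithout_pos ↔ MultiplicationThree := by
  constructor
  · exact fun h s _ r r' hr hri hr' hri' => h s r r' hr hri hr' hri'
  · intro h s r r' hr hri hr' hri'
    rcases lt_or_ge 0 s with hs | hs
    · exact h s hs r r' hr hri hr' hri'
    · exact (no_boxRep_of_nonpos hs r hr hri).elim

end Summit.KontsevichZagierPeriods.TerasomaMultiplication.MultiplicationThreeNegative
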